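import Mathlib.RingTheory.PowerSeries.Basic
import Mathlib.RingTheory.PowerSeries.Inverse
import Mathlib.RingTheory.Polynomial.Eisenstein.IsIntegral
import Mathlib.RingTheory.DiscreteValuationRing.Basic
import Mathlib.RingTheory.KrullDimension.Basic
import Mathlib.RingTheory.Ideal.Quotient.Operations
import Mathlib.RingTheory.Noetherian.Basic
import Literature.NumberTheory.EllipticCurves.PlusMinusPAdicLFunction
import HarnessLib

/-!
# Route `SignedLowerHalves`, crux L `SmallImageLowerHalfBothSigns` (stmt-BirchSwinnertonDyer-23599), line `rtt_w3` v30 — row S4′ (`stub_junctionReciprocity_ns`), brick β7 (core), LEAD g14: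
# A POWER SERIES DIVISIBLE BY DISTINGUISHED POLYNOMIALS OF UNBOUNDED DEGREE IS ZERO (hence: Kobayashi/Pollack congruences modulo `X·ω_n^±` for infinitely many `n` PIN an
# element of `𝒪⟦T⟧`)

WHY (MEMO `Lines/rtt_w3-MEMO-S4prime-lead-g14.md`, brick β7; also LEAD g13's disprover-wanted (i) «is `L` pinned by `hcongr`?»). The last step of the reciprocity row S4′ compares
two INTEGRAL power series (`Col^ε(jv(s ζ̄_𝔞))` and `c·v·L`) that satisfy the same congruences modulo `ω_n = X·ω_n^+·ω_n^-` for all `n` of one parity; their difference is then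
divisible by `X·ω_n^{±}` for infinitely many `n`, i.e. by monic polynomials that are `≡ X^{deg}` modulo the maximal ideal ("distinguished") of unbounded degree. THIS FILE proves,
in kernel commutative algebra, that such a power series vanishes:

* §1 (any domain `R`, prime `π` with `⋂ (π^j) = 0`): `dvd_coeff_of_monic_mul_eq_C_mul` (`P·q = π·z`, `P` monic ⟹ `π ∣` every coefficient of `q`, reduction to the domain
  `(R/π)⟦X⟧`), `dvd_coeff_of_distinguished_dvd` (`P ∣ z` ⟹ `π ∣ coeff_i z` for `i < deg P`), ★★ `eq_zero_of_forall_distinguished_dvd` (induction `y ∈ π^j R⟦X⟧` for all `j`);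
* §2 distinguished polynomials are stable under products (`map_eq_X_pow_of_distinguished`, `distinguished_mul`, `distinguished_prod`), `X` and `Φ_{p^{m+1}}(1+X)` are
  distinguished when `π ∣ p` (Eisenstein, Mathlib `cyclotomic_prime_pow_comp_X_add_one_isEisensteinAt`);
* §3 ★★ `eq_zero_of_forall_even_X_mul_cyclotomicOmegaPlus_dvd` / `…odd…Minus…`: over such `R` (e.g. `𝒪 = padicCoeffIntegers S`, a DVR — `eq_zero_of_forall_distinguished_dvd_of_dvr`),
  `X·ω_n^+ ∣ y` for all even `n` (resp. `X·ω_n^- ∣ y` for all odd `n`) forces `y = 0`;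
* (sequel `…RttReciprocityUniqueCongr`) §4 ★★★ `eq_of_forall_isCongrModOmegaO` — IN THE EXACT SHAPE OF THE SKELETON'S `hcongr`: two elements `A, B ∈ 𝒪⟦T⟧` (`𝒪 = padicCoeffIntegers S` a DVR, `p` a non-unit) with
  `IsCongrModOmegaO S n (θ n) (((−1)^{n/2+1}·ω_n^∓)·ι A)` and the same for `B`, for every `n` of parity `ε`, are EQUAL (so `L` is pinned by `hcongr`; and S4′'s two sides agree once
  they satisfy the same congruences); via `exists_X_mul_dvd_C_pow_mul_sub_of_isCongrModOmegaO` (two solutions differ integrally by a multiple of `X·ω_n^±` up to `p^M`) and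
  `dvd_of_monic_of_dvd_C_mul_of_dvr` (remove `p^M`).

THEOREMS ONLY (`--supports stmt-BirchSwinnertonDyer-23599` helper); closes nothing; S4′, crux L and BSD remain OPEN and are proved for NO curve by any of this.
[cite: Washington1997, §7.1 Prop. 7.2–7.3 (distinguished polynomials, Weierstrass preparation)] [cite: Pollack2003, §6.5 (before Prop. 6.18)] [cite: Sprung2017, Thm. 1.12 (uniqueness)] [folklore]
-/

set_option autoImplicit false
-- the Theorems namespace of this sub repeats the summit name by design (D-0017 nested layout)
set_option linter.dupNamespace false

noncomputable section

open Polynomial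

namespace Summit.BirchSwinnertonDyer.BirchSwinnertonDyer.Theorems.SmallImageRttReciprocity

/-! ## §1 Divisibility by distinguished polynomials of unbounded degree -/

section Generic

variable {R : Type*} [CommRing R] [IsDomain R] {π : R}

omit [IsDomain R] in
/-- **`P·q = π·z` with `P` monic and `π` prime ⟹ `π` divides every coefficient of `q`** (reduce to the domain `(R/π)⟦X⟧`, where `P̄ ≠ 0`). [folklore] -/
theorem dvd_coeff_of_monic_mul_eq_C_mul (hπ : Prime π) {P : R[X]} (hP : P.Monic) {q z : PowerSeries R}
    (h : (P : PowerSeries R) * q = PowerSeries.C π * z) (i : ℕ) : π ∣ PowerSeries.coeff i q := by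
  classical
  haveI hprime : (Ideal.span {π}).IsPrime := (Ideal.span_singleton_prime hπ.ne_zero).mpr hπ
  set φ : PowerSeries R →+* PowerSeries (R ⧸ Ideal.span {π}) := PowerSeries.map (Ideal.Quotient.mk (Ideal.span {π})) with hφ
  have hφπ : φ (PowerSeries.C π) = 0 := by
    rw [hφ, PowerSeries.map_C, (Ideal.Quotient.eq_zero_iff_dvd π π).mpr (dvd_refl π), map_zero]
  have hP0 : φ (P : PowerSeries R) ≠ 0 := by
    intro h0
    have h1 := congrArg (PowerSeries.coeff P.natDegree) h0
    rw [hφ, PowerSeries.coeff_map, Polynomial.coeff_coe, hP.coeff_natDegree, map_one, map_zero] at h1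
    exact one_ne_zero h1
  have hprod : φ (P : PowerSeries R) * φ q = 0 := by rw [← map_mul, h, map_mul, hφπ, zero_mul]
  have hq : φ q = 0 := (mul_eq_zero.mp hprod).resolve_left hP0
  have hi := congrArg (PowerSeries.coeff i) hq
  rw [hφ, PowerSeries.coeff_map, map_zero] at hi
  exact (Ideal.Quotient.eq_zero_iff_dvd π _).mp hi

omit [IsDomain R] in
/-- **A multiple of a distinguished polynomial has its low coefficients divisible by `π`**: if `P` has `π ∣ coeff_a P` for all `a < deg P` and `P ∣ z` in `R⟦X⟧`, then
`π ∣ coeff_i z` for every `i < deg P`. [cite: Washington1997, §7.1] [folklore] -/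
theorem dvd_coeff_of_distinguished_dvd {P : R[X]} (hlow : ∀ a, a < P.natDegree → π ∣ P.coeff a) {z : PowerSeries R}
    (h : (P : PowerSeries R) ∣ z) {i : ℕ} (hi : i < P.natDegree) : π ∣ PowerSeries.coeff i z := by
  obtain ⟨q, rfl⟩ := h
  rw [PowerSeries.coeff_mul]
  refine Finset.dvd_sum fun ab hab ↦ ?_
  rw [Polynomial.coeff_coe]
  have hab' := Finset.HasAntidiagonal.mem_antidiagonal.mp hab
  exact dvd_mul_of_dvd_left (hlow ab.1 (by omega)) _

/-- ★★ **A power series divisible by distinguished polynomials of unbounded degree is zero.** `R` a domain, `π` a prime with `⋂_j π^j R = 0`; `P n` monic with all lower coefficients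
divisible by `π`, of unbounded degrees, and `P n ∣ y` for every `n` ⟹ `y = 0`. (Induction: if `y = π^j z` with every `P n ∣ z`, the low coefficients of `z` — all of them, the degrees
being unbounded — are divisible by `π`, so `z = π z′`, and `P n ∣ z′` again because `P̄ n ≠ 0` in the domain `(R/π)⟦X⟧`.) [cite: Washington1997, §7.1 Prop. 7.2] [folklore] -/
theorem eq_zero_of_forall_distinguished_dvd (hπ : Prime π) (hK : ∀ x : R, (∀ j : ℕ, π ^ j ∣ x) → x = 0)
    (P : ℕ → R[X]) (hmonic : ∀ n, (P n).Monic) (hlow : ∀ n a, a < (P n).natDegree → π ∣ (P n).coeff a)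
    (hdeg : ∀ d : ℕ, ∃ n, d ≤ (P n).natDegree) {y : PowerSeries R} (hdvd : ∀ n, ((P n : R[X]) : PowerSeries R) ∣ y) : y = 0 := by
  classical
  have hCπ : (PowerSeries.C π : PowerSeries R) ≠ 0 := fun h0 ↦ hπ.ne_zero (PowerSeries.C_injective (h0.trans (map_zero _).symm))
  -- every coefficient of a series divisible by all `P n` is divisible by `π`
  have hstep : ∀ z : PowerSeries R, (∀ n, ((P n : R[X]) : PowerSeries R) ∣ z) → ∀ i, π ∣ PowerSeries.coeff i z := by
    intro z hz i
    obtain ⟨n, hn⟩ := hdeg (i + 1)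
    exact dvd_coeff_of_distinguished_dvd (hlow n) (hz n) (by omega)
  -- peel one factor `π` and keep the divisibilities
  have hpeel : ∀ z : PowerSeries R, (∀ n, ((P n : R[X]) : PowerSeries R) ∣ z) →
      ∃ z' : PowerSeries R, z = PowerSeries.C π * z' ∧ ∀ n, ((P n : R[X]) : PowerSeries R) ∣ z' := by
    intro z hz
    choose c hc using hstep z hz
    refine ⟨PowerSeries.mk c, ?_, fun n ↦ ?_⟩
    · ext i
      rw [PowerSeries.coeff_C_mul, PowerSeries.coeff_mk]
      exact hc i
    · obtain ⟨q, hq⟩ := hz n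
      have hq' : ((P n : R[X]) : PowerSeries R) * q = PowerSeries.C π * PowerSeries.mk c := by
        rw [← hq]; ext i; rw [PowerSeries.coeff_C_mul, PowerSeries.coeff_mk]; exact hc i
      choose c' hc' using dvd_coeff_of_monic_mul_eq_C_mul hπ (hmonic n) hq'
      refine ⟨PowerSeries.mk c', mul_left_cancel₀ hCπ ?_⟩
      rw [← hq', show q = PowerSeries.C π * PowerSeries.mk c' from by
        ext i; rw [PowerSeries.coeff_C_mul, PowerSeries.coeff_mk]; exact hc' i]
      ring
  -- hence `y ∈ π^j R⟦X⟧` for every `j`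
  have hall : ∀ j : ℕ, ∃ z : PowerSeries R, y = PowerSeries.C (π ^ j) * z ∧ ∀ n, ((P n : R[X]) : PowerSeries R) ∣ z := by
    intro j
    induction j with
    | zero => exact ⟨y, by simp, hdvd⟩
    | succ j ih =>
      obtain ⟨z, hz, hzd⟩ := ih
      obtain ⟨z', hz', hz'd⟩ := hpeel z hzd
      refine ⟨z', ?_, hz'd⟩
      rw [hz, hz', ← mul_assoc, ← map_mul, pow_succ]
  ext i
  rw [map_zero]
  refine hK _ fun j ↦ ?_
  obtain ⟨z, hz, -⟩ := hall j
  rw [hz, PowerSeries.coeff_C_mul]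
  exact dvd_mul_right _ _

/-- The same over a discrete valuation ring with uniformizer `π` (Krull's intersection theorem supplies `⋂_j π^j R = 0`; `π` is prime). The case of the line: `R = 𝒪 = padicCoeffIntegers S`.
[cite: Washington1997, §7.1 Prop. 7.2] [folklore] -/
theorem eq_zero_of_forall_distinguished_dvd_of_dvr [IsDiscreteValuationRing R] (hπ : Irreducible π)
    (P : ℕ → R[X]) (hmonic : ∀ n, (P n).Monic) (hlow : ∀ n a, a < (P n).natDegree → π ∣ (P n).coeff a)
    (hdeg : ∀ d : ℕ, ∃ n, d ≤ (P n).natDegree) {y : PowerSeries R} (hdvd : ∀ n, ((P n : R[X]) : PowerSeries R) ∣ y) : y = 0 := by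
  refine eq_zero_of_forall_distinguished_dvd hπ.prime (fun x hx ↦ ?_) P hmonic hlow hdeg hdvd
  have hmax : IsLocalRing.maximalIdeal R = Ideal.span {π} := (IsDiscreteValuationRing.irreducible_iff_uniformizer π).mp hπ
  have hmem : x ∈ ⨅ i : ℕ, (IsLocalRing.maximalIdeal R) ^ i := by
    refine Ideal.mem_iInf.mpr fun i ↦ ?_
    rw [hmax, Ideal.span_singleton_pow]
    exact Ideal.mem_span_singleton.mpr (hx i)
  rwa [Ideal.iInf_pow_eq_bot_of_isLocalRing _ (IsLocalRing.maximalIdeal.isMaximal R).ne_top, Ideal.mem_bot] at hmem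

end Generic

/-! ## §2 Distinguished polynomials: products, `X`, `Φ_{p^{m+1}}(1+X)` -/

section Distinguished

variable {R : Type*} [CommRing R] {π : R}

/-- A monic polynomial whose lower coefficients are divisible by `π` reduces to `X^{deg}` modulo `π`. [cite: Washington1997, §7.1] [folklore] -/
theorem map_eq_X_pow_of_distinguished {P : R[X]} (hP : P.Monic) (hlow : ∀ a, a < P.natDegree → π ∣ P.coeff a) :
    P.map (Ideal.Quotient.mk (Ideal.span {π})) = X ^ P.natDegree := by
  ext a
  rw [Polynomial.coeff_map, Polynomial.coeff_X_pow]
  rcases lt_trichotomy a P.natDegree with h | h | h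
  · rw [if_neg h.ne, (Ideal.Quotient.eq_zero_iff_dvd π _).mpr (hlow a h)]
  · rw [if_pos h, h, hP.coeff_natDegree, map_one]
  · rw [if_neg h.ne', Polynomial.coeff_eq_zero_of_natDegree_lt h, map_zero]

/-- Conversely, for a monic `P` with `P ≡ X^{deg P} (mod π)` the lower coefficients are divisible by `π`. [folklore] -/
theorem dvd_coeff_of_map_eq_X_pow {P : R[X]} (h : P.map (Ideal.Quotient.mk (Ideal.span {π})) = X ^ P.natDegree)
    {a : ℕ} (ha : a < P.natDegree) : π ∣ P.coeff a := by
  have h1 := congrArg (fun Q : (R ⧸ Ideal.span {π})[X] ↦ Q.coeff a) h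
  simp only [Polynomial.coeff_map, Polynomial.coeff_X_pow, if_neg ha.ne] at h1
  exact (Ideal.Quotient.eq_zero_iff_dvd π _).mp h1

/-- **Products of distinguished polynomials are distinguished** (monic, and `≡ X^{deg}` modulo `π`). [cite: Washington1997, §7.1] [folklore] -/
theorem distinguished_mul [Nontrivial R] {P Q : R[X]} (hP : P.Monic) (hPl : ∀ a, a < P.natDegree → π ∣ P.coeff a)
    (hQ : Q.Monic) (hQl : ∀ a, a < Q.natDegree → π ∣ Q.coeff a) :
    (P * Q).Monic ∧ ∀ a, a < (P * Q).natDegree → π ∣ (P * Q).coeff a := by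
  refine ⟨hP.mul hQ, fun a ha ↦ dvd_coeff_of_map_eq_X_pow ?_ ha⟩
  rw [Polynomial.map_mul, map_eq_X_pow_of_distinguished hP hPl, map_eq_X_pow_of_distinguished hQ hQl, ← pow_add, hP.natDegree_mul hQ]

/-- Finite products of distinguished polynomials are distinguished. [cite: Washington1997, §7.1] [folklore] -/
theorem distinguished_prod [Nontrivial R] {ι : Type*} (s : Finset ι) (f : ι → R[X]) (hf : ∀ i ∈ s, (f i).Monic)
    (hfl : ∀ i ∈ s, ∀ a, a < (f i).natDegree → π ∣ (f i).coeff a) :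
    (∏ i ∈ s, f i).Monic ∧ ∀ a, a < (∏ i ∈ s, f i).natDegree → π ∣ (∏ i ∈ s, f i).coeff a := by
  classical
  induction s using Finset.induction_on with
  | empty =>
    refine ⟨by simp [Polynomial.monic_one], fun a ha ↦ ?_⟩
    simp at ha
  | insert i s hi ih =>
    rw [Finset.prod_insert hi]
    exact distinguished_mul (hf i (Finset.mem_insert_self i s)) (hfl i (Finset.mem_insert_self i s))
      (ih (fun k hk ↦ hf k (Finset.mem_insert_of_mem hk)) (fun k hk ↦ hfl k (Finset.mem_insert_of_mem hk))).1
      (ih (fun k hk ↦ hf k (Finset.mem_insert_of_mem hk)) (fun k hk ↦ hfl k (Finset.mem_insert_of_mem hk))).2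

/-- `X` is distinguished. [folklore] -/
theorem distinguished_X [Nontrivial R] : (X : R[X]).Monic ∧ ∀ a, a < (X : R[X]).natDegree → π ∣ (X : R[X]).coeff a := by
  refine ⟨monic_X, fun a ha ↦ ?_⟩
  rw [natDegree_X] at ha
  have : a = 0 := by omega
  subst this
  rw [coeff_X_zero]
  exact dvd_zero π

/-- **`Φ_{p^{m+1}}(1+X)` is distinguished for any `π ∣ p`** (it is Eisenstein at `p` over `ℤ`, Mathlib `cyclotomic_prime_pow_comp_X_add_one_isEisensteinAt`), after base change
`ℤ → R`. [cite: Washington1997, §7.1] [folklore] -/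
theorem distinguished_cyclotomic_comp_X_add_one [Nontrivial R] {p : ℕ} [hp : Fact p.Prime] (hπp : π ∣ (p : R)) (m : ℕ) :
    (((cyclotomic (p ^ (m + 1)) ℤ).comp (X + 1)).map (Int.castRingHom R)).Monic ∧
      ∀ a, a < (((cyclotomic (p ^ (m + 1)) ℤ).comp (X + 1)).map (Int.castRingHom R)).natDegree →
        π ∣ (((cyclotomic (p ^ (m + 1)) ℤ).comp (X + 1)).map (Int.castRingHom R)).coeff a := by
  have hmonicZ : ((cyclotomic (p ^ (m + 1)) ℤ).comp (X + 1)).Monic :=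
    (cyclotomic.monic _ ℤ).comp (monic_X_add_C 1) (by rw [← C_1, natDegree_X_add_C]; exact one_ne_zero)
  refine ⟨hmonicZ.map _, fun a ha ↦ ?_⟩
  rw [hmonicZ.natDegree_map] at ha
  have hE := cyclotomic_prime_pow_comp_X_add_one_isEisensteinAt p m
  have hmem : ((cyclotomic (p ^ (m + 1)) ℤ).comp (X + 1)).coeff a ∈ Submodule.span ℤ {(p : ℤ)} := hE.mem ha
  rw [Ideal.mem_span_singleton] at hmem
  obtain ⟨c, hc⟩ := hmem
  rw [Polynomial.coeff_map, hc, map_mul, map_natCast]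
  exact dvd_mul_of_dvd_left hπp _

end Distinguished

/-! ## §3 Kobayashi's half-products `X·ω_n^±`: divisibility for infinitely many `n` forces vanishing -/

section Omega

open Literature.NumberTheory.EllipticCurves

variable {R : Type*} [CommRing R] [IsDomain R] {π : R} {p : ℕ} [hp : Fact p.Prime]

/-- `X·ω_n^+` (base-changed to `R`) is distinguished for `π ∣ p`, of degree `≥ n/2`. [cite: Pollack2003, §6.5 (before Prop. 6.18)] [folklore] -/
theorem distinguished_X_mul_cyclotomicOmegaPlus (hπp : π ∣ (p : R)) (n : ℕ) :
    ((X * cyclotomicOmegaPlus p n).map (Int.castRingHom R)).Monic ∧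
      (∀ a, a < ((X * cyclotomicOmegaPlus p n).map (Int.castRingHom R)).natDegree → π ∣ ((X * cyclotomicOmegaPlus p n).map (Int.castRingHom R)).coeff a) ∧
      n / 2 ≤ ((X * cyclotomicOmegaPlus p n).map (Int.castRingHom R)).natDegree := by
  classical
  rw [cyclotomicOmegaPlus, Polynomial.map_mul, Polynomial.map_X, Polynomial.map_prod]
  have hfac : ∀ k ∈ Finset.Icc 1 (n / 2), (((cyclotomic (p ^ (2 * k)) ℤ).comp (X + 1)).map (Int.castRingHom R)).Monic ∧
      ∀ a, a < (((cyclotomic (p ^ (2 * k)) ℤ).comp (X + 1)).map (Int.castRingHom R)).natDegree →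
        π ∣ (((cyclotomic (p ^ (2 * k)) ℤ).comp (X + 1)).map (Int.castRingHom R)).coeff a := by
    intro k hk
    rw [Finset.mem_Icc] at hk
    obtain ⟨m, hm⟩ : ∃ m, 2 * k = m + 1 := ⟨2 * k - 1, by omega⟩
    rw [hm]
    exact distinguished_cyclotomic_comp_X_add_one hπp m
  have hprod := distinguished_prod (π := π) (Finset.Icc 1 (n / 2)) _ (fun k hk ↦ (hfac k hk).1) (fun k hk ↦ (hfac k hk).2)
  have hX := distinguished_X (R := R) (π := π)
  have hall := distinguished_mul hX.1 hX.2 hprod.1 hprod.2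
  refine ⟨hall.1, hall.2, ?_⟩
  rw [monic_X.natDegree_mul hprod.1, natDegree_X, Polynomial.natDegree_prod_of_monic _ _ (fun k hk ↦ (hfac k hk).1)]
  have h1 : ∀ k ∈ Finset.Icc 1 (n / 2), 1 ≤ (((cyclotomic (p ^ (2 * k)) ℤ).comp (X + 1)).map (Int.castRingHom R)).natDegree := by
    intro k hk
    rw [Finset.mem_Icc] at hk
    have hmonicZ : ((cyclotomic (p ^ (2 * k)) ℤ).comp (X + 1)).Monic :=
      (cyclotomic.monic _ ℤ).comp (monic_X_add_C 1) (by rw [← C_1, natDegree_X_add_C]; exact one_ne_zero)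
    rw [hmonicZ.natDegree_map, Polynomial.natDegree_comp, ← C_1, natDegree_X_add_C, mul_one, Polynomial.natDegree_cyclotomic]
    exact Nat.totient_pos.mpr (pow_pos hp.out.pos _)
  calc n / 2 = ∑ _k ∈ Finset.Icc 1 (n / 2), 1 := by simp
    _ ≤ ∑ k ∈ Finset.Icc 1 (n / 2), (((cyclotomic (p ^ (2 * k)) ℤ).comp (X + 1)).map (Int.castRingHom R)).natDegree := Finset.sum_le_sum h1
    _ ≤ 1 + _ := Nat.le_add_left _ _

/-- `X·ω_n^-` (base-changed to `R`) is distinguished for `π ∣ p`, of degree `≥ (n+1)/2`. [cite: Pollack2003, §6.5 (before Prop. 6.18)] [folklore] -/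
theorem distinguished_X_mul_cyclotomicOmegaMinus (hπp : π ∣ (p : R)) (n : ℕ) :
    ((X * cyclotomicOmegaMinus p n).map (Int.castRingHom R)).Monic ∧
      (∀ a, a < ((X * cyclotomicOmegaMinus p n).map (Int.castRingHom R)).natDegree → π ∣ ((X * cyclotomicOmegaMinus p n).map (Int.castRingHom R)).coeff a) ∧
      (n + 1) / 2 ≤ ((X * cyclotomicOmegaMinus p n).map (Int.castRingHom R)).natDegree := by
  classical
  rw [cyclotomicOmegaMinus, Polynomial.map_mul, Polynomial.map_X, Polynomial.map_prod]
  have hfac : ∀ k ∈ Finset.Icc 1 ((n + 1) / 2), (((cyclotomic (p ^ (2 * k - 1)) ℤ).comp (X + 1)).map (Int.castRingHom R)).Monic ∧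
      ∀ a, a < (((cyclotomic (p ^ (2 * k - 1)) ℤ).comp (X + 1)).map (Int.castRingHom R)).natDegree →
        π ∣ (((cyclotomic (p ^ (2 * k - 1)) ℤ).comp (X + 1)).map (Int.castRingHom R)).coeff a := by
    intro k hk
    rw [Finset.mem_Icc] at hk
    obtain ⟨m, hm⟩ : ∃ m, 2 * k - 1 = m + 1 := ⟨2 * k - 2, by omega⟩
    rw [hm]
    exact distinguished_cyclotomic_comp_X_add_one hπp m
  have hprod := distinguished_prod (π := π) (Finset.Icc 1 ((n + 1) / 2)) _ (fun k hk ↦ (hfac k hk).1) (fun k hk ↦ (hfac k hk).2)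
  have hX := distinguished_X (R := R) (π := π)
  have hall := distinguished_mul hX.1 hX.2 hprod.1 hprod.2
  refine ⟨hall.1, hall.2, ?_⟩
  rw [monic_X.natDegree_mul hprod.1, natDegree_X, Polynomial.natDegree_prod_of_monic _ _ (fun k hk ↦ (hfac k hk).1)]
  have h1 : ∀ k ∈ Finset.Icc 1 ((n + 1) / 2), 1 ≤ (((cyclotomic (p ^ (2 * k - 1)) ℤ).comp (X + 1)).map (Int.castRingHom R)).natDegree := by
    intro k hk
    rw [Finset.mem_Icc] at hk
    have hmonicZ : ((cyclotomic (p ^ (2 * k - 1)) ℤ).comp (X + 1)).Monic :=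
      (cyclotomic.monic _ ℤ).comp (monic_X_add_C 1) (by rw [← C_1, natDegree_X_add_C]; exact one_ne_zero)
    rw [hmonicZ.natDegree_map, Polynomial.natDegree_comp, ← C_1, natDegree_X_add_C, mul_one, Polynomial.natDegree_cyclotomic]
    exact Nat.totient_pos.mpr (pow_pos hp.out.pos _)
  calc (n + 1) / 2 = ∑ _k ∈ Finset.Icc 1 ((n + 1) / 2), 1 := by simp
    _ ≤ ∑ k ∈ Finset.Icc 1 ((n + 1) / 2), (((cyclotomic (p ^ (2 * k - 1)) ℤ).comp (X + 1)).map (Int.castRingHom R)).natDegree := Finset.sum_le_sum h1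
    _ ≤ 1 + _ := Nat.le_add_left _ _

/-- ★★ **Congruences modulo `X·ω_n^+` for all even `n` pin an element of `R⟦X⟧`**: if `X·ω_n^+ ∣ y` for every even `n` (`R` a domain, `π` prime with `⋂ π^j R = 0`, `π ∣ p`), then
`y = 0`. Use: the difference of two solutions of the sign-`+` Kobayashi/Pollack congruences `θ_n ≡ ± ω_n^- · L (mod ω_n)`, `n` even (`ω_n = X·ω_n^+·ω_n^-`).
[cite: Pollack2003, §6.5 Prop. 6.18] [cite: Sprung2017, Thm. 1.12 (uniqueness)] -/
theorem eq_zero_of_forall_even_X_mul_cyclotomicOmegaPlus_dvd (hπ : Prime π) (hK : ∀ x : R, (∀ j : ℕ, π ^ j ∣ x) → x = 0)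
    (hπp : π ∣ (p : R)) {y : PowerSeries R}
    (h : ∀ n : ℕ, Even n → (((X * cyclotomicOmegaPlus p n).map (Int.castRingHom R) : R[X]) : PowerSeries R) ∣ y) : y = 0 := by
  refine eq_zero_of_forall_distinguished_dvd hπ hK (fun d ↦ (X * cyclotomicOmegaPlus p (2 * d)).map (Int.castRingHom R))
    (fun d ↦ (distinguished_X_mul_cyclotomicOmegaPlus hπp (2 * d)).1) (fun d ↦ (distinguished_X_mul_cyclotomicOmegaPlus hπp (2 * d)).2.1)
    (fun d ↦ ⟨d, ?_⟩) (fun d ↦ h (2 * d) (even_two_mul d))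
  have := (distinguished_X_mul_cyclotomicOmegaPlus (π := π) hπp (2 * d)).2.2
  omega

/-- ★★ **Congruences modulo `X·ω_n^-` for all odd `n` pin an element of `R⟦X⟧`** (sign `−`: `θ_n ≡ ± ω_n^+ · L (mod ω_n)`, `n` odd). [cite: Pollack2003, §6.5 Prop. 6.18]
[cite: Sprung2017, Thm. 1.12 (uniqueness)] -/
theorem eq_zero_of_forall_odd_X_mul_cyclotomicOmegaMinus_dvd (hπ : Prime π) (hK : ∀ x : R, (∀ j : ℕ, π ^ j ∣ x) → x = 0)
    (hπp : π ∣ (p : R)) {y : PowerSeries R}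
    (h : ∀ n : ℕ, Odd n → (((X * cyclotomicOmegaMinus p n).map (Int.castRingHom R) : R[X]) : PowerSeries R) ∣ y) : y = 0 := by
  refine eq_zero_of_forall_distinguished_dvd hπ hK (fun d ↦ (X * cyclotomicOmegaMinus p (2 * d + 1)).map (Int.castRingHom R))
    (fun d ↦ (distinguished_X_mul_cyclotomicOmegaMinus hπp (2 * d + 1)).1) (fun d ↦ (distinguished_X_mul_cyclotomicOmegaMinus hπp (2 * d + 1)).2.1)
    (fun d ↦ ⟨d, ?_⟩) (fun d ↦ h (2 * d + 1) (odd_two_mul_add_one d))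
  have := (distinguished_X_mul_cyclotomicOmegaMinus (π := π) hπp (2 * d + 1)).2.2
  omega

end Omega

end Summit.BirchSwinnertonDyer.BirchSwinnertonDyer.Theorems.SmallImageRttReciprocity
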